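import Literature.Topology.FourManifolds.BandSumFoliation
import HarnessLib

/-!
# The detour of a band sum in a foliated chart, I: reparametrisations and arches

Topic `Literature/Topology/FourManifolds`; sequel of `BandSumFoliation.lean` in the decomposition
of the Fox–Milnor congruence `Literature.Topology.FourManifolds.Knot.IsConnectedSum.isConcordant`.
The connected sum inside a tube chart is the union of the core line (first summand), a lower
arch, the small copy of the second summand traversed the long way round from one end of its
flat segment to the other, an upper arch, and the core line again. For the whole to be one
`C^∞` regular curve, consecutive pieces must *agree as parametrised curves on open overlaps*;
this file prepares the parametrisations that make this literal, in the square coordinates of the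
band chart. Everything here is proved (real analysis; the arches come from `exists_planarArch`,
the blends from `exists_blend_deriv_pos/neg`, `PlanarArch.lean`).

* `BandFoliation.SegData C` — the flat segment of the small knot seen from the chart `C`: its
  `θ`-coordinate `S` as a function of the knot parameter (strictly decreasing on the flat window
  `[α, β]`, sweeping past the doubled `θ`-interval) and a junction length `c₁`; the parameters
  `θA`, `θD` of the knot at the two right corners of the band (`S θA = θlo`, `S θD = θhi`,
  intermediate value theorem), `θD < θA`, `Ltot = θD + 2π - θA > 0`.
* `SegData.s₀` — a **slow slope** (`exists_slow`): windows of half-width `s₀ c₁` around `θA`,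
  `θD` stay in the flat window with `S` within a quarter band width of the corner values.
* `SegData.θhat` — the **slow–fast–slow reparametrisation** of the middle piece over
  `[uA, uD] = [θlo + c₁, θhi - c₁]`: affine of slope `s₀` through `(uA, θA)` and
  `(uD, θD + 2π)` near the ends (`θhat_of_le/ge`), strictly increasing (`deriv_θhat_pos`).
* `ChartData.θaffInv` — the inverse affine coordinate; the **end profiles**
  `E t = θaffInv (S (θhat (θlo + c₁ t)))` and `Eup t = θaffInv (S (θhat (uD + c₁ t) - 2π))`
  (`E 1 = -δ`, `Eup 0 = 1 + δ`), `C^∞`, strictly decreasing with explicit derivative on their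
  zones, with values within `(1 + 2δ)/4` of the corner values (`abs_E_add_δ_lt`,
  `abs_Eup_sub_lt`).
* **The arches** `SegData.cLo`, `SegData.cUp : ℝ → ℝ²` (`exists_planarArch` with the left profile
  `fLo t = -δ + v t`, `v = c₁/slope ≤ 1/4`, and the right profile `E` blended beyond `t = 5/4`;
  resp. the reflection of an arch with profiles `1 - Eup` (blended before `-1/4`) and the affine
  `gUp`): `C^∞`, injective, regular, from corner to corner, inside the lower (resp. upper) half
  of the square neighbourhood on `(0, 1)` (`cLo_mem`, `cUp_mem`), and with the **junction
  formulas** `cLo t = pt2 0 (fLo t)` (`t ≤ 1/8`, so `θaff ∘ fLo` is the core parameter,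
  `θaff_fLo`), `cLo t = pt2 1 (E t)` (`t ∈ [7/8, 5/4]`), `cUp t = pt2 1 (Eup t)`
  (`t ∈ [-1/4, 1/8]`), `cUp t = pt2 0 (θaffInv (uD + c₁ t))` (`t ≥ 7/8`).

## References

* P. R. Cromwell, *Knots and Links* (2004), §4.6. [Cromwell2004]
* R. H. Fox, J. W. Milnor, Osaka J. Math. 3 (1966), §1 (the consumer). [FoxMilnor1966]
-/

open Set Function
open scoped Topology ContDiff

noncomputable section

namespace Literature.Topology.FourManifolds

namespace BandFoliation

/-- Local notation: `𝔼 n` is the model Euclidean space `EuclideanSpace ℝ (Fin n)`. -/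
local notation "𝔼 " n:arg => EuclideanSpace ℝ (Fin n)

/-! ### The flat segment seen from the band: data -/

/-- **Data of the flat segment of the second summand, relative to a band chart.** A `C^∞`
function `S` (the `θ`-coordinate of the flat part of the small knot as a function of its own
parameter) strictly decreasing on `[α, β]` (`β < α + 2π`), sweeping an interval which contains
the doubled `θ`-interval of the chart with room, and a junction speed `c₁`. [folklore] -/
structure SegData (C : ChartData) where
  /-- The `θ`-coordinate of the flat part as a function of the parameter of the small knot. -/
  S : ℝ → ℝ
  /-- Start of the flat parameter window. -/
  α : ℝ
  /-- End of the flat parameter window. -/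
  β : ℝ
  /-- The parameter length of the two arch pieces. -/
  c₁ : ℝ
  contDiff_S : ContDiff ℝ ∞ S
  α_lt_β : α < β
  β_lt : β < α + 2 * Real.pi
  deriv_S_neg : ∀ θ ∈ Icc α β, deriv S θ < 0
  S_β_lt : S β < C.θlo - C.wid
  lt_S_α : C.θhi + C.wid < S α
  c₁_pos : 0 < c₁
  c₁_le : c₁ ≤ C.wid / (1 + 2 * C.δ) / 4
  c₁_lt : 4 * c₁ < C.wid

namespace SegData

variable {C : ChartData} (D : SegData C)

/-- `S` is continuous. [folklore] -/
theorem continuous_S : Continuous D.S := D.contDiff_S.continuous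

/-- `S` is strictly decreasing on `[α, β]`. [folklore] -/
theorem strictAntiOn_S : StrictAntiOn D.S (Icc D.α D.β) :=
  strictAntiOn_of_deriv_neg (convex_Icc _ _) D.continuous_S.continuousOn fun θ hθ ↦
    D.deriv_S_neg θ (interior_subset hθ)

/-- **Parameters of the flat part over a prescribed `θ`-coordinate** in the doubled interval
exist (intermediate value theorem), in the open window. [folklore] -/
theorem exists_S_eq {θ₀ : ℝ} (hθ₀ : θ₀ ∈ Icc (C.θlo - C.wid) (C.θhi + C.wid)) :
    ∃ t ∈ Ioo D.α D.β, D.S t = θ₀ := by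
  have h := intermediate_value_Icc' D.α_lt_β.le D.continuous_S.continuousOn
  have hmem : θ₀ ∈ Icc (D.S D.β) (D.S D.α) :=
    ⟨by linarith [hθ₀.1, D.S_β_lt], by linarith [hθ₀.2, D.lt_S_α]⟩
  obtain ⟨t, ht, hts⟩ := h hmem
  refine ⟨t, ⟨lt_of_le_of_ne ht.1 ?_, lt_of_le_of_ne ht.2 ?_⟩, hts⟩
  · rintro rfl; linarith [hθ₀.2, D.lt_S_α]
  · rintro rfl; linarith [hθ₀.1, D.S_β_lt]

/-- The corner `θlo` lies in the doubled interval. [folklore] -/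
theorem θlo_mem : C.θlo ∈ Icc (C.θlo - C.wid) (C.θhi + C.wid) :=
  ⟨by linarith [C.wid_pos], by linarith [C.wid_pos, C.θlo_lt]⟩

/-- The corner `θhi` lies in the doubled interval. [folklore] -/
theorem θhi_mem : C.θhi ∈ Icc (C.θlo - C.wid) (C.θhi + C.wid) :=
  ⟨by linarith [C.wid_pos, C.θlo_lt], by linarith [C.wid_pos]⟩

/-- **The parameter `θ^A`** of the small knot at the lower-right corner of the band:
`S θ^A = θlo`. [folklore] -/
def θA : ℝ := Classical.choose (D.exists_S_eq (θlo_mem (C := C)))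

/-- The defining property of `θ^A`. [folklore] -/
theorem θA_spec : D.θA ∈ Ioo D.α D.β ∧ D.S D.θA = C.θlo :=
  Classical.choose_spec (D.exists_S_eq (θlo_mem (C := C)))

/-- **The parameter `θ^D`** of the small knot at the upper-right corner of the band:
`S θ^D = θhi`. [folklore] -/
def θD : ℝ := Classical.choose (D.exists_S_eq (θhi_mem (C := C)))

/-- The defining property of `θ^D`. [folklore] -/
theorem θD_spec : D.θD ∈ Ioo D.α D.β ∧ D.S D.θD = C.θhi :=
  Classical.choose_spec (D.exists_S_eq (θhi_mem (C := C)))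

/-- `θ^D < θ^A` (`S` is decreasing and `θlo < θhi`). [folklore] -/
theorem θD_lt_θA : D.θD < D.θA := by
  by_contra h
  push Not at h
  have := D.strictAntiOn_S.antitoneOn (Ioo_subset_Icc_self D.θA_spec.1)
    (Ioo_subset_Icc_self D.θD_spec.1) h
  rw [D.θA_spec.2, D.θD_spec.2] at this
  linarith [C.θlo_lt]

/-- The total parameter length of the middle piece: from `θ^A` the long way round to
`θ^D + 2π`. [folklore] -/
def Ltot : ℝ := D.θD + 2 * Real.pi - D.θA

/-- The total length is positive. [folklore] -/
theorem Ltot_pos : 0 < D.Ltot := by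
  rw [Ltot]
  have h1 := D.θA_spec.1
  have h2 := D.θD_spec.1
  linarith [D.β_lt, h1.2, h2.1]

/-! ### The slow slope at the junctions -/

/-- **A slow slope exists**: `s₀ > 0` so small that the parameter windows
`[θ^A - s₀ c₁, θ^A + s₀ c₁]`, `[θ^D - s₀ c₁, θ^D + s₀ c₁]` stay in the open flat window, the
`θ`-coordinates `S` over them stay within a quarter band width of the corners, the middle
reparametrisation has positive slope, and the extended middle parameter range
`[θ^A - s₀ c₁, θ^D + 2π + s₀ c₁]` is shorter than a period. [folklore] -/
theorem exists_slow : ∃ s₀ : ℝ, 0 < s₀ ∧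
    Icc (D.θA - s₀ * D.c₁) (D.θA + s₀ * D.c₁) ⊆ Ioo D.α D.β ∧
    Icc (D.θD - s₀ * D.c₁) (D.θD + s₀ * D.c₁) ⊆ Ioo D.α D.β ∧
    (∀ θ ∈ Icc (D.θA - s₀ * D.c₁) (D.θA + s₀ * D.c₁), |D.S θ - C.θlo| < C.wid / 4) ∧
    (∀ θ ∈ Icc (D.θD - s₀ * D.c₁) (D.θD + s₀ * D.c₁), |D.S θ - C.θhi| < C.wid / 4) ∧
    s₀ * C.wid < D.Ltot ∧ s₀ * D.c₁ < D.θA - D.θD := by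
  have hc := D.c₁_pos
  have hw := C.wid_pos
  have hA := D.θA_spec
  have hD := D.θD_spec
  -- neighbourhoods of `θ^A`, `θ^D` inside the window where `S` is close to the corner value
  have hSA : ∀ᶠ θ in 𝓝 D.θA, θ ∈ Ioo D.α D.β ∧ |D.S θ - C.θlo| < C.wid / 4 := by
    refine (isOpen_Ioo.eventually_mem hA.1).and ?_
    have hcA : ContinuousAt D.S D.θA := D.continuous_S.continuousAt
    rw [ContinuousAt, hA.2] at hcA
    have h := Metric.tendsto_nhds.1 hcA (C.wid / 4) (by linarith)
    filter_upwards [h] with θ hθ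
    rwa [Real.dist_eq] at hθ
  have hSD : ∀ᶠ θ in 𝓝 D.θD, θ ∈ Ioo D.α D.β ∧ |D.S θ - C.θhi| < C.wid / 4 := by
    refine (isOpen_Ioo.eventually_mem hD.1).and ?_
    have hcD : ContinuousAt D.S D.θD := D.continuous_S.continuousAt
    rw [ContinuousAt, hD.2] at hcD
    have h := Metric.tendsto_nhds.1 hcD (C.wid / 4) (by linarith)
    filter_upwards [h] with θ hθ
    rwa [Real.dist_eq] at hθ
  obtain ⟨rA, hrA, hrAsub⟩ := Metric.mem_nhds_iff.1 hSA
  obtain ⟨rD, hrD, hrDsub⟩ := Metric.mem_nhds_iff.1 hSD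
  have hAD : 0 < D.θA - D.θD := by linarith [D.θD_lt_θA]
  set s₀ := min (min (min (rA / (2 * D.c₁)) (rD / (2 * D.c₁))) (D.Ltot / (2 * C.wid)))
    ((D.θA - D.θD) / (2 * D.c₁)) with hs₀
  have hs₀pos : 0 < s₀ :=
    lt_min (lt_min (lt_min (by positivity) (by positivity)) (div_pos D.Ltot_pos (by positivity)))
      (div_pos hAD (by positivity))
  have h1 : s₀ * D.c₁ < rA := by
    have hle : s₀ ≤ rA / (2 * D.c₁) := ((min_le_left _ _).trans (min_le_left _ _)).trans (min_le_left _ _)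
    calc s₀ * D.c₁ ≤ rA / (2 * D.c₁) * D.c₁ := mul_le_mul_of_nonneg_right hle hc.le
      _ = rA / 2 := by field_simp
      _ < rA := by linarith
  have h2 : s₀ * D.c₁ < rD := by
    have hle : s₀ ≤ rD / (2 * D.c₁) := ((min_le_left _ _).trans (min_le_left _ _)).trans (min_le_right _ _)
    calc s₀ * D.c₁ ≤ rD / (2 * D.c₁) * D.c₁ := mul_le_mul_of_nonneg_right hle hc.le
      _ = rD / 2 := by field_simp
      _ < rD := by linarith
  have hballA : Icc (D.θA - s₀ * D.c₁) (D.θA + s₀ * D.c₁) ⊆ Metric.ball D.θA rA := fun θ hθ ↦ by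
    rw [Metric.mem_ball, Real.dist_eq, abs_lt]; constructor <;> linarith [hθ.1, hθ.2]
  have hballD : Icc (D.θD - s₀ * D.c₁) (D.θD + s₀ * D.c₁) ⊆ Metric.ball D.θD rD := fun θ hθ ↦ by
    rw [Metric.mem_ball, Real.dist_eq, abs_lt]; constructor <;> linarith [hθ.1, hθ.2]
  refine ⟨s₀, hs₀pos, fun θ hθ ↦ (hrAsub (hballA hθ)).1, fun θ hθ ↦ (hrDsub (hballD hθ)).1,
    fun θ hθ ↦ (hrAsub (hballA hθ)).2, fun θ hθ ↦ (hrDsub (hballD hθ)).2, ?_, ?_⟩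
  · have hle : s₀ ≤ D.Ltot / (2 * C.wid) := (min_le_left _ _).trans (min_le_right _ _)
    calc s₀ * C.wid ≤ D.Ltot / (2 * C.wid) * C.wid := mul_le_mul_of_nonneg_right hle hw.le
      _ = D.Ltot / 2 := by field_simp
      _ < D.Ltot := by linarith [D.Ltot_pos]
  · have hle : s₀ ≤ (D.θA - D.θD) / (2 * D.c₁) := min_le_right _ _
    calc s₀ * D.c₁ ≤ (D.θA - D.θD) / (2 * D.c₁) * D.c₁ := mul_le_mul_of_nonneg_right hle hc.le
      _ = (D.θA - D.θD) / 2 := by field_simp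
      _ < D.θA - D.θD := by linarith

/-- **The slow slope** `s₀`. [folklore] -/
def s₀ : ℝ := Classical.choose D.exists_slow

/-- The defining properties of the slow slope. [folklore] -/
theorem s₀_spec : 0 < D.s₀ ∧
    Icc (D.θA - D.s₀ * D.c₁) (D.θA + D.s₀ * D.c₁) ⊆ Ioo D.α D.β ∧
    Icc (D.θD - D.s₀ * D.c₁) (D.θD + D.s₀ * D.c₁) ⊆ Ioo D.α D.β ∧
    (∀ θ ∈ Icc (D.θA - D.s₀ * D.c₁) (D.θA + D.s₀ * D.c₁), |D.S θ - C.θlo| < C.wid / 4) ∧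
    (∀ θ ∈ Icc (D.θD - D.s₀ * D.c₁) (D.θD + D.s₀ * D.c₁), |D.S θ - C.θhi| < C.wid / 4) ∧
    D.s₀ * C.wid < D.Ltot ∧ D.s₀ * D.c₁ < D.θA - D.θD :=
  Classical.choose_spec D.exists_slow

/-- The slow slope is positive. [folklore] -/
theorem s₀_pos : 0 < D.s₀ := D.s₀_spec.1

/-! ### The reparametrisation of the middle piece -/

/-- Start of the middle piece: `uA = θlo + c₁`. [folklore] -/
def uA : ℝ := C.θlo + D.c₁

/-- End of the middle piece: `uD = θhi - c₁`. [folklore] -/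
def uD : ℝ := C.θhi - D.c₁

/-- `uA < uD` with room. [folklore] -/
theorem uA_lt_uD : D.uA + D.c₁ < D.uD - D.c₁ := by
  rw [uA, uD]; have := D.c₁_lt; rw [ChartData.wid] at this; linarith

/-- **The slow–fast–slow reparametrisation** `θ̂` of the middle piece: affine of slope `s₀`
through `(uA, θ^A)` near `uA`, through `(uD, θ^D + 2π)` near `uD`, strictly increasing, the
difference being absorbed by a smooth step in the middle. [folklore] -/
def θhat (u : ℝ) : ℝ :=
  D.θA + D.s₀ * (u - D.uA) +
    (D.Ltot - D.s₀ * (D.uD - D.uA)) * smoothStep (D.uA + D.c₁ / 2) (D.uD - D.c₁ / 2) u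

/-- The middle step interval is nondegenerate. [folklore] -/
theorem step_lt : D.uA + D.c₁ / 2 < D.uD - D.c₁ / 2 := by linarith [D.uA_lt_uD, D.c₁_pos]

/-- The amplitude of the fast part is positive. [folklore] -/
theorem amp_pos : 0 < D.Ltot - D.s₀ * (D.uD - D.uA) := by
  have h := D.s₀_spec.2.2.2.2.2.1
  have : D.uD - D.uA ≤ C.wid := by rw [uD, uA, ChartData.wid]; linarith [D.c₁_pos]
  nlinarith [D.s₀_pos]

/-- Near `uA` the reparametrisation is the slow affine map through `(uA, θ^A)`. [folklore] -/
theorem θhat_of_le {u : ℝ} (hu : u ≤ D.uA + D.c₁ / 2) : D.θhat u = D.θA + D.s₀ * (u - D.uA) := by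
  rw [θhat, smoothStep_of_le D.step_lt hu, mul_zero, add_zero]

/-- Near `uD` the reparametrisation is the slow affine map through `(uD, θ^D + 2π)`. [folklore] -/
theorem θhat_of_ge {u : ℝ} (hu : D.uD - D.c₁ / 2 ≤ u) :
    D.θhat u = D.θD + 2 * Real.pi + D.s₀ * (u - D.uD) := by
  rw [θhat, smoothStep_of_ge D.step_lt hu, mul_one, Ltot]; ring

/-- The reparametrisation is `C^∞`. [folklore] -/
theorem contDiff_θhat : ContDiff ℝ ∞ D.θhat := by
  unfold θhat
  exact (contDiff_const.add (contDiff_const.mul (contDiff_id.sub contDiff_const))).add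
    (contDiff_const.mul (contDiff_smoothStep _ _))

/-- The derivative of the reparametrisation. [folklore] -/
theorem hasDerivAt_θhat (u : ℝ) :
    HasDerivAt D.θhat (D.s₀ + (D.Ltot - D.s₀ * (D.uD - D.uA)) *
      deriv (smoothStep (D.uA + D.c₁ / 2) (D.uD - D.c₁ / 2)) u) u := by
  unfold θhat
  have h1 : HasDerivAt (fun u ↦ D.θA + D.s₀ * (u - D.uA)) D.s₀ u := by
    simpa using (((hasDerivAt_id u).sub_const D.uA).const_mul D.s₀).const_add D.θA
  have h2 := ((differentiable_smoothStep (D.uA + D.c₁ / 2) (D.uD - D.c₁ / 2) u).hasDerivAt).const_mul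
    (D.Ltot - D.s₀ * (D.uD - D.uA))
  exact h1.add h2

/-- **The reparametrisation has derivative at least the slow slope**, in particular it is
positive. [folklore] -/
theorem s₀_le_deriv_θhat (u : ℝ) : D.s₀ ≤ deriv D.θhat u := by
  rw [(D.hasDerivAt_θhat u).deriv]
  have := mul_nonneg D.amp_pos.le (deriv_smoothStep_nonneg D.step_lt u)
  linarith

/-- The reparametrisation has positive derivative. [folklore] -/
theorem deriv_θhat_pos (u : ℝ) : 0 < deriv D.θhat u := lt_of_lt_of_le D.s₀_pos (D.s₀_le_deriv_θhat u)

/-- The reparametrisation is strictly increasing. [folklore] -/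
theorem strictMono_θhat : StrictMono D.θhat :=
  strictMono_of_deriv_pos D.deriv_θhat_pos

end SegData

/-! ### The inverse affine coordinate -/

namespace ChartData

variable (C : ChartData)

/-- The slope of the affine coordinate `θaff`. [folklore] -/
def slope : ℝ := C.wid / (1 + 2 * C.δ)

/-- The slope is positive. [folklore] -/
theorem slope_pos' : 0 < C.slope := C.slope_pos

/-- **The inverse affine coordinate** `θ ↦ x₁`: `θaffInv θ = (θ - θlo)/slope - δ`. [folklore] -/
def θaffInv (θ : ℝ) : ℝ := (θ - C.θlo) / C.slope - C.δ

/-- `θaff ∘ θaffInv = id`. [folklore] -/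
@[simp] theorem θaff_θaffInv (θ : ℝ) : C.θaff (C.θaffInv θ) = θ := by
  rw [θaffInv, ChartData.θaff, slope]
  have hw : C.wid ≠ 0 := C.wid_pos.ne'
  have h2 : (1 + 2 * C.δ) ≠ 0 := by linarith [C.δ_pos]
  field_simp
  ring

/-- `θaffInv ∘ θaff = id`. [folklore] -/
@[simp] theorem θaffInv_θaff (x : ℝ) : C.θaffInv (C.θaff x) = x := by
  rw [θaffInv, ChartData.θaff, slope]
  have hs : C.wid / (1 + 2 * C.δ) ≠ 0 := C.slope_pos.ne'
  rw [show C.θlo + (x + C.δ) * (C.wid / (1 + 2 * C.δ)) - C.θlo = (x + C.δ) * (C.wid / (1 + 2 * C.δ)) by ring,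
    mul_div_cancel_right₀ _ hs]
  ring

/-- `θaffInv θlo = -δ`. [folklore] -/
@[simp] theorem θaffInv_θlo : C.θaffInv C.θlo = -C.δ := by simp [θaffInv]

/-- `θaffInv θhi = 1 + δ`. [folklore] -/
@[simp] theorem θaffInv_θhi : C.θaffInv C.θhi = 1 + C.δ := by
  rw [← C.θaff_one_add_δ, θaffInv_θaff]

/-- The inverse affine coordinate has derivative `1/slope`. [folklore] -/
theorem hasDerivAt_θaffInv (θ : ℝ) : HasDerivAt C.θaffInv (1 / C.slope) θ := by
  unfold θaffInv
  simpa using (((hasDerivAt_id θ).sub_const C.θlo).div_const C.slope).sub_const C.δ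

/-- The inverse affine coordinate is `C^∞`. [folklore] -/
theorem contDiff_θaffInv : ContDiff ℝ ∞ C.θaffInv := by
  unfold θaffInv
  exact ((contDiff_id.sub contDiff_const).div_const _).sub contDiff_const

/-- Distances in `x₁` are distances in `θ` divided by the slope. [folklore] -/
theorem θaffInv_sub (θ θ' : ℝ) : C.θaffInv θ - C.θaffInv θ' = (θ - θ') / C.slope := by
  rw [θaffInv, θaffInv]; ring

end ChartData

namespace SegData

variable {C : ChartData} (D : SegData C)

/-! ### The end profiles -/

/-- **The lower end profile** `E t = θaffInv (S (θ̂ (θlo + c₁ t)))`: the `x₁`-coordinate of the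
point of the small knot at the parameter reached at time `t` of the lower arch. [folklore] -/
def E (t : ℝ) : ℝ := C.θaffInv (D.S (D.θhat (C.θlo + D.c₁ * t)))

/-- **The upper end profile** `Ẽ t = θaffInv (S (θ̂ (uD + c₁ t) - 2π))` (the parameter of the
small knot is read one period down, inside the flat window). [folklore] -/
def Eup (t : ℝ) : ℝ := C.θaffInv (D.S (D.θhat (D.uD + D.c₁ * t) - 2 * Real.pi))

/-- `E 1 = -δ` (the lower-right corner). [folklore] -/
theorem E_one : D.E 1 = -C.δ := by
  rw [E, mul_one, show C.θlo + D.c₁ = D.uA from rfl, D.θhat_of_le (by linarith [D.c₁_pos]), sub_self,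
    mul_zero, add_zero, D.θA_spec.2, C.θaffInv_θlo]

/-- `Ẽ 0 = 1 + δ` (the upper-right corner). [folklore] -/
theorem Eup_zero : D.Eup 0 = 1 + C.δ := by
  rw [Eup, mul_zero, add_zero, D.θhat_of_ge (by linarith [D.c₁_pos]), sub_self, mul_zero, add_zero,
    add_sub_cancel_right, D.θD_spec.2, C.θaffInv_θhi]

/-- The parameter along the lower arch: for `t ∈ [0, 3/2]`,
`θ̂ (θlo + c₁ t) = θ^A + s₀ c₁ (t - 1)` lies in the slow window around `θ^A`. [folklore] -/
theorem θhat_lo {t : ℝ} (ht : t ∈ Icc (0 : ℝ) (3 / 2)) :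
    D.θhat (C.θlo + D.c₁ * t) = D.θA + D.s₀ * D.c₁ * (t - 1) ∧
      D.θhat (C.θlo + D.c₁ * t) ∈ Icc (D.θA - D.s₀ * D.c₁) (D.θA + D.s₀ * D.c₁) := by
  have hc := D.c₁_pos
  have hs := D.s₀_pos
  have h1 : D.θhat (C.θlo + D.c₁ * t) = D.θA + D.s₀ * D.c₁ * (t - 1) := by
    rw [D.θhat_of_le (by rw [uA]; nlinarith [ht.2]), uA]; ring
  refine ⟨h1, ?_⟩
  rw [h1]
  constructor <;> nlinarith [ht.1, ht.2, mul_pos hs hc]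

/-- The parameter along the upper arch: for `t ∈ [-1/2, 1]`,
`θ̂ (uD + c₁ t) - 2π = θ^D + s₀ c₁ t` lies in the slow window around `θ^D`. [folklore] -/
theorem θhat_up {t : ℝ} (ht : t ∈ Icc (-(1 / 2) : ℝ) 1) :
    D.θhat (D.uD + D.c₁ * t) - 2 * Real.pi = D.θD + D.s₀ * D.c₁ * t ∧
      D.θhat (D.uD + D.c₁ * t) - 2 * Real.pi ∈ Icc (D.θD - D.s₀ * D.c₁) (D.θD + D.s₀ * D.c₁) := by
  have hc := D.c₁_pos
  have hs := D.s₀_pos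
  have h1 : D.θhat (D.uD + D.c₁ * t) - 2 * Real.pi = D.θD + D.s₀ * D.c₁ * t := by
    rw [D.θhat_of_ge (by nlinarith [ht.1])]; ring
  refine ⟨h1, ?_⟩
  rw [h1]
  constructor <;> nlinarith [ht.1, ht.2, mul_pos hs hc]

/-- **The lower end profile is `C^∞`.** [folklore] -/
theorem contDiff_E : ContDiff ℝ ∞ D.E :=
  C.contDiff_θaffInv.comp (D.contDiff_S.comp (D.contDiff_θhat.comp
    (contDiff_const.add (contDiff_const.mul contDiff_id))))

/-- **The upper end profile is `C^∞`.** [folklore] -/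
theorem contDiff_Eup : ContDiff ℝ ∞ D.Eup :=
  C.contDiff_θaffInv.comp (D.contDiff_S.comp ((D.contDiff_θhat.comp
    (contDiff_const.add (contDiff_const.mul contDiff_id))).sub contDiff_const))

/-- The derivative of the lower end profile on its zone `(0, 3/2)`. [folklore] -/
theorem hasDerivAt_E {t : ℝ} (ht : t ∈ Ioo (0 : ℝ) (3 / 2)) :
    HasDerivAt D.E (deriv D.S (D.θA + D.s₀ * D.c₁ * (t - 1)) * (D.s₀ * D.c₁) / C.slope) t := by
  -- near `t` the profile is `θaffInv (S (θA + s₀ c₁ (t - 1)))`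
  have hev : D.E =ᶠ[𝓝 t] fun t ↦ C.θaffInv (D.S (D.θA + D.s₀ * D.c₁ * (t - 1))) := by
    filter_upwards [isOpen_Ioo.mem_nhds ht] with s hs
    rw [E, (D.θhat_lo ⟨hs.1.le, hs.2.le⟩).1]
  refine HasDerivAt.congr_of_eventuallyEq ?_ hev
  have h1 : HasDerivAt (fun t ↦ D.θA + D.s₀ * D.c₁ * (t - 1)) (D.s₀ * D.c₁) t := by
    simpa using (((hasDerivAt_id t).sub_const (1:ℝ)).const_mul (D.s₀ * D.c₁)).const_add D.θA
  have h2 : HasDerivAt D.S (deriv D.S (D.θA + D.s₀ * D.c₁ * (t - 1))) (D.θA + D.s₀ * D.c₁ * (t - 1)) :=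
    ((D.contDiff_S.differentiable (by simp)) _).hasDerivAt
  have h3 := h2.comp t h1
  have h4 := (C.hasDerivAt_θaffInv _).comp t h3
  exact h4.congr_deriv (by rw [div_eq_mul_one_div]; ring)

/-- The derivative of the upper end profile on its zone `(-1/2, 1)`. [folklore] -/
theorem hasDerivAt_Eup {t : ℝ} (ht : t ∈ Ioo (-(1 / 2) : ℝ) 1) :
    HasDerivAt D.Eup (deriv D.S (D.θD + D.s₀ * D.c₁ * t) * (D.s₀ * D.c₁) / C.slope) t := by
  have hev : D.Eup =ᶠ[𝓝 t] fun t ↦ C.θaffInv (D.S (D.θD + D.s₀ * D.c₁ * t)) := by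
    filter_upwards [isOpen_Ioo.mem_nhds ht] with s hs
    rw [Eup, (D.θhat_up ⟨hs.1.le, hs.2.le⟩).1]
  refine HasDerivAt.congr_of_eventuallyEq ?_ hev
  have h1 : HasDerivAt (fun t ↦ D.θD + D.s₀ * D.c₁ * t) (D.s₀ * D.c₁) t := by
    simpa using ((hasDerivAt_id t).const_mul (D.s₀ * D.c₁)).const_add D.θD
  have h2 : HasDerivAt D.S (deriv D.S (D.θD + D.s₀ * D.c₁ * t)) (D.θD + D.s₀ * D.c₁ * t) :=
    ((D.contDiff_S.differentiable (by simp)) _).hasDerivAt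
  have h3 := h2.comp t h1
  have h4 := (C.hasDerivAt_θaffInv _).comp t h3
  exact h4.congr_deriv (by rw [div_eq_mul_one_div]; ring)

/-- **The lower end profile is strictly decreasing on its zone**: `E' < 0` on `(0, 3/2)`.
[folklore] -/
theorem deriv_E_neg {t : ℝ} (ht : t ∈ Ioo (0 : ℝ) (3 / 2)) : deriv D.E t < 0 := by
  rw [(D.hasDerivAt_E ht).deriv]
  have hmem := (D.θhat_lo ⟨ht.1.le, ht.2.le⟩)
  have hwin := D.s₀_spec.2.1 (hmem.1 ▸ hmem.2)
  have hS := D.deriv_S_neg _ (Ioo_subset_Icc_self hwin)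
  exact div_neg_of_neg_of_pos (mul_neg_of_neg_of_pos hS (mul_pos D.s₀_pos D.c₁_pos)) C.slope_pos'

/-- **The upper end profile is strictly decreasing on its zone**: `Ẽ' < 0` on `(-1/2, 1)`.
[folklore] -/
theorem deriv_Eup_neg {t : ℝ} (ht : t ∈ Ioo (-(1 / 2) : ℝ) 1) : deriv D.Eup t < 0 := by
  rw [(D.hasDerivAt_Eup ht).deriv]
  have hmem := (D.θhat_up ⟨ht.1.le, ht.2.le⟩)
  have hwin := D.s₀_spec.2.2.1 (hmem.1 ▸ hmem.2)
  have hS := D.deriv_S_neg _ (Ioo_subset_Icc_self hwin)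
  exact div_neg_of_neg_of_pos (mul_neg_of_neg_of_pos hS (mul_pos D.s₀_pos D.c₁_pos)) C.slope_pos'

/-- **Values of the lower end profile on its zone**: `|E t + δ| < (1 + 2δ)/4`. [folklore] -/
theorem abs_E_add_δ_lt {t : ℝ} (ht : t ∈ Icc (0 : ℝ) (3 / 2)) : |D.E t + C.δ| < (1 + 2 * C.δ) / 4 := by
  have hclose := D.s₀_spec.2.2.2.1 _ (D.θhat_lo ht).2
  have hs := C.slope_pos'
  have e : D.E t + C.δ = (D.S (D.θhat (C.θlo + D.c₁ * t)) - C.θlo) / C.slope := by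
    rw [E, ChartData.θaffInv]; ring
  rw [e, abs_div, abs_of_pos hs, div_lt_iff₀ hs, ChartData.slope]
  have hw : C.wid / 4 = (1 + 2 * C.δ) / 4 * (C.wid / (1 + 2 * C.δ)) := by
    have : (1 + 2 * C.δ) ≠ 0 := by linarith [C.δ_pos]
    field_simp
  linarith [hw]

/-- **Values of the upper end profile on its zone**: `|Ẽ t - (1 + δ)| < (1 + 2δ)/4`. [folklore] -/
theorem abs_Eup_sub_lt {t : ℝ} (ht : t ∈ Icc (-(1 / 2) : ℝ) 1) :
    |D.Eup t - (1 + C.δ)| < (1 + 2 * C.δ) / 4 := by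
  have hclose := D.s₀_spec.2.2.2.2.1 _ (D.θhat_up ht).2
  have hs := C.slope_pos'
  have e : D.Eup t - (1 + C.δ) = (D.S (D.θhat (D.uD + D.c₁ * t) - 2 * Real.pi) - C.θhi) / C.slope := by
    rw [Eup, ← C.θaffInv_θhi, ChartData.θaffInv_sub]
  rw [e, abs_div, abs_of_pos hs, div_lt_iff₀ hs, ChartData.slope]
  have hw : C.wid / 4 = (1 + 2 * C.δ) / 4 * (C.wid / (1 + 2 * C.δ)) := by
    have : (1 + 2 * C.δ) ≠ 0 := by linarith [C.δ_pos]
    field_simp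
  linarith [hw]

/-! ### The lower arch -/

/-- The speed of the arches along the edges in square coordinates: `v = c₁ / slope ≤ 1/4`.
[folklore] -/
def v : ℝ := D.c₁ / C.slope

/-- `0 < v`. [folklore] -/
theorem v_pos : 0 < D.v := div_pos D.c₁_pos C.slope_pos'

/-- `v ≤ 1/4`. [folklore] -/
theorem v_le : D.v ≤ 1 / 4 := by
  rw [v, div_le_iff₀ C.slope_pos', ChartData.slope]
  have := D.c₁_le
  linarith

/-- `c₁ = v · slope`. [folklore] -/
theorem c₁_eq : D.c₁ = D.v * C.slope := by
  rw [v, div_mul_cancel₀ _ C.slope_pos'.ne']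

/-- **The left profile of the lower arch**: the affine continuation `-δ + v t` of the left edge
(`θaff (-δ + v t) = θlo + c₁ t`). [folklore] -/
def fLo (t : ℝ) : ℝ := -C.δ + D.v * t

/-- The affine coordinate of the left profile is the core parameter. [folklore] -/
theorem θaff_fLo (t : ℝ) : C.θaff (D.fLo t) = C.θlo + D.c₁ * t := by
  rw [fLo, ChartData.θaff, c₁_eq, ChartData.slope]; ring

/-- `fLo` is `C^∞` with derivative `v`. [folklore] -/
theorem hasDerivAt_fLo (t : ℝ) : HasDerivAt D.fLo D.v t := by
  unfold fLo; simpa using ((hasDerivAt_id t).const_mul D.v).const_add (-C.δ)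

/-- The lower end profile is strictly decreasing on `[0, 3/2]`. [folklore] -/
theorem strictAntiOn_E : StrictAntiOn D.E (Icc (0 : ℝ) (3 / 2)) :=
  strictAntiOn_of_deriv_neg (convex_Icc _ _) D.contDiff_E.continuous.continuousOn fun t ht ↦
    D.deriv_E_neg (by rwa [interior_Icc] at ht)

/-- **The right profile of the lower arch**: the end profile `E` up to `t = 5/4`, blended into a
decreasing affine function beyond (`exists_blend_deriv_neg`), so that it is strictly decreasing
on all of `[3/4, ∞)`. [folklore] -/
theorem exists_gLo : ∃ g : ℝ → ℝ, ContDiff ℝ ∞ g ∧ (∀ t, t ≤ 5 / 4 → g t = D.E t) ∧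
    ∀ t, 3 / 4 ≤ t → deriv g t < 0 := by
  set p₂ : ℝ → ℝ := fun t ↦ D.E (11 / 8) - (t - 5 / 4) with hp₂
  have hp₂s : ContDiff ℝ ∞ p₂ := contDiff_const.sub (contDiff_id.sub contDiff_const)
  have hp₂d : ∀ t, HasDerivAt p₂ (-1) t := fun t ↦ by
    simpa using ((hasDerivAt_id t).sub_const (5 / 4 : ℝ)).const_sub (D.E (11 / 8))
  obtain ⟨H, hHs, hl, hr, hd, -⟩ := exists_blend_deriv_neg (a := 5 / 4) (b := 11 / 8) (by norm_num)
    D.contDiff_E hp₂s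
    (fun t ht ↦ by
      have hE : D.E (11 / 8) ≤ D.E t := D.strictAntiOn_E.antitoneOn ⟨by linarith [ht.1], by linarith [ht.2]⟩
        ⟨by norm_num, by norm_num⟩ ht.2
      show D.E (11 / 8) - (t - 5 / 4) ≤ D.E t
      linarith [ht.1])
    (fun t ht ↦ D.deriv_E_neg ⟨by linarith [ht.1], by linarith [ht.2]⟩)
    (fun t _ ↦ by rw [(hp₂d t).deriv]; norm_num)
  refine ⟨H, hHs, hl, fun t ht ↦ ?_⟩
  rcases lt_or_ge t (5 / 4) with h1 | h1
  · -- `H = E` near `t`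
    have hev : H =ᶠ[𝓝 t] D.E := by
      filter_upwards [Iio_mem_nhds h1] with s hs using hl s hs.le
    rw [hev.deriv_eq]; exact D.deriv_E_neg ⟨by linarith, by linarith⟩
  rcases le_or_gt t (11 / 8) with h2 | h2
  · exact hd t ⟨h1, h2⟩
  · have hev : H =ᶠ[𝓝 t] p₂ := by
      filter_upwards [Ioi_mem_nhds h2] with s hs using hr s hs.le
    rw [hev.deriv_eq, (hp₂d t).deriv]; norm_num

/-- The right profile of the lower arch. [folklore] -/
def gLo : ℝ → ℝ := Classical.choose D.exists_gLo

/-- The defining properties of `gLo`. [folklore] -/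
theorem gLo_spec : ContDiff ℝ ∞ D.gLo ∧ (∀ t, t ≤ 5 / 4 → D.gLo t = D.E t) ∧
    ∀ t, 3 / 4 ≤ t → deriv D.gLo t < 0 := Classical.choose_spec D.exists_gLo

/-- **The lower arch exists** (`exists_planarArch` with `θ₁ = 0`, `θ₂ = 1`, `ε = 1/8`). [folklore] -/
theorem exists_cLo : ∃ c : ℝ → 𝔼 2, ContDiff ℝ ∞ c ∧
    (∀ t, t ≤ 0 + 1 / 8 → c t = pt2 0 (D.fLo t)) ∧
    (∀ t, 1 - 1 / 8 ≤ t → c t = pt2 1 (D.gLo t)) ∧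
    (∀ t ∈ Ioo (0 + 1 / 8) (1 - 1 / 8), c t 0 ∈ Ioo (0 : ℝ) 1) ∧
    (∀ t, c t 0 ∈ Icc (0 : ℝ) 1) ∧
    (∀ t, c t 1 ∈ uIcc (D.fLo t) (D.gLo t)) ∧
    Injective c ∧ ∀ t, deriv c t ≠ 0 :=
  exists_planarArch (θ₁ := 0) (θ₂ := 1) (ε := 1 / 8) (by norm_num) (by norm_num)
    (contDiff_const.add (contDiff_const.mul contDiff_id)) D.gLo_spec.1
    (fun t _ ↦ by rw [(D.hasDerivAt_fLo t).deriv]; exact D.v_pos)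
    (fun t ht ↦ D.gLo_spec.2.2 t (by linarith))

/-- **The lower arch** in square coordinates. [folklore] -/
def cLo : ℝ → 𝔼 2 := Classical.choose D.exists_cLo

/-- The defining properties of the lower arch. [folklore] -/
theorem cLo_spec : ContDiff ℝ ∞ D.cLo ∧
    (∀ t, t ≤ 0 + 1 / 8 → D.cLo t = pt2 0 (D.fLo t)) ∧
    (∀ t, 1 - 1 / 8 ≤ t → D.cLo t = pt2 1 (D.gLo t)) ∧
    (∀ t ∈ Ioo (0 + 1 / 8) (1 - 1 / 8), D.cLo t 0 ∈ Ioo (0 : ℝ) 1) ∧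
    (∀ t, D.cLo t 0 ∈ Icc (0 : ℝ) 1) ∧
    (∀ t, D.cLo t 1 ∈ uIcc (D.fLo t) (D.gLo t)) ∧
    Injective D.cLo ∧ ∀ t, deriv D.cLo t ≠ 0 := Classical.choose_spec D.exists_cLo

/-- Near its start the lower arch runs up the left edge line. [folklore] -/
theorem cLo_of_le {t : ℝ} (ht : t ≤ 1 / 8) : D.cLo t = pt2 0 (D.fLo t) := D.cLo_spec.2.1 t (by linarith)

/-- Near its end, and one quarter beyond, the lower arch runs down the right edge line along the
end profile `E`. [folklore] -/
theorem cLo_of_mem {t : ℝ} (ht : t ∈ Icc (7 / 8 : ℝ) (5 / 4)) : D.cLo t = pt2 1 (D.E t) := by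
  rw [D.cLo_spec.2.2.1 t (by linarith [ht.1]), D.gLo_spec.2.1 t ht.2]

/-- The lower arch starts at the lower-left corner. [folklore] -/
theorem cLo_zero : D.cLo 0 = pt2 0 (-C.δ) := by rw [D.cLo_of_le (by norm_num)]; simp [fLo]

/-- The lower arch ends at the lower-right corner. [folklore] -/
theorem cLo_one : D.cLo 1 = pt2 1 (-C.δ) := by rw [D.cLo_of_mem ⟨by norm_num, by norm_num⟩, E_one]

/-- The end profile on `(0, 1)` lies in `(-δ, 1/2)`. [folklore] -/
theorem E_mem {t : ℝ} (ht : t ∈ Ioo (0 : ℝ) 1) : D.E t ∈ Ioo (-C.δ) (1 / 2) := by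
  have h1 : D.E 1 < D.E t := D.strictAntiOn_E ⟨ht.1.le, by linarith [ht.2]⟩ ⟨by norm_num, by norm_num⟩ ht.2
  rw [E_one] at h1
  have h2 := D.abs_E_add_δ_lt ⟨ht.1.le, by linarith [ht.2]⟩
  rw [abs_lt] at h2
  exact ⟨h1, by linarith [h2.2, C.δ_le]⟩

/-- **The open lower arch lies in the lower half of the square neighbourhood.** [folklore] -/
theorem cLo_mem {t : ℝ} (ht : t ∈ Ioo (0 : ℝ) 1) : D.cLo t ∈ squareNhd C.δ ∧ D.cLo t 1 < 2⁻¹ := by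
  have hδ := C.δ_pos
  have h0 := D.cLo_spec.2.2.2.2.1 t
  have h1 := D.cLo_spec.2.2.2.2.2.1 t
  rw [D.gLo_spec.2.1 t (by linarith [ht.2])] at h1
  have hf : D.fLo t ∈ Ioo (-C.δ) (1 / 2) := by
    constructor
    · rw [fLo]; nlinarith [D.v_pos, ht.1]
    · rw [fLo]; nlinarith [D.v_le, ht.2, D.v_pos]
  have hE := D.E_mem ht
  have h1' : D.cLo t 1 ∈ Ioo (-C.δ) (1 / 2) := by
    rcases le_total (D.fLo t) (D.E t) with hle | hle
    · rw [uIcc_of_le hle] at h1; exact ⟨lt_of_lt_of_le hf.1 h1.1, lt_of_le_of_lt h1.2 hE.2⟩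
    · rw [uIcc_of_ge hle] at h1; exact ⟨lt_of_lt_of_le hE.1 h1.1, lt_of_le_of_lt h1.2 hf.2⟩
  refine ⟨fun i ↦ ?_, by norm_num at h1' ⊢; exact h1'.2⟩
  fin_cases i
  · change D.cLo t 0 ∈ Ioo (-C.δ) (1 + C.δ)
    exact ⟨by linarith [h0.1], by linarith [h0.2]⟩
  · change D.cLo t 1 ∈ Ioo (-C.δ) (1 + C.δ)
    exact ⟨h1'.1, by linarith [h1'.2]⟩

/-! ### The upper arch -/

/-- The upper end profile is strictly decreasing on `[-1/2, 1]`. [folklore] -/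
theorem strictAntiOn_Eup : StrictAntiOn D.Eup (Icc (-(1 / 2) : ℝ) 1) :=
  strictAntiOn_of_deriv_neg (convex_Icc _ _) D.contDiff_Eup.continuous.continuousOn fun t ht ↦
    D.deriv_Eup_neg (by rwa [interior_Icc] at ht)

/-- **The left profile of the reflected upper arch**: `1 - Ẽ` from `t = -1/4` on, blended into an
increasing affine function to the left (`exists_blend_deriv_pos`), so that it is strictly
increasing on all of `(-∞, 1/4]`. [folklore] -/
theorem exists_fUp : ∃ f : ℝ → ℝ, ContDiff ℝ ∞ f ∧ (∀ t, -(1 / 4) ≤ t → f t = 1 - D.Eup t) ∧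
    ∀ t, t ≤ 1 / 4 → 0 < deriv f t := by
  set p₂ : ℝ → ℝ := fun t ↦ 1 - D.Eup t with hp₂
  set p₁ : ℝ → ℝ := fun t ↦ p₂ (-(3 / 8)) - 1 + 8 * (t + 3 / 8) with hp₁
  have hp₂s : ContDiff ℝ ∞ p₂ := contDiff_const.sub D.contDiff_Eup
  have hp₁s : ContDiff ℝ ∞ p₁ := contDiff_const.add (contDiff_const.mul (contDiff_id.add contDiff_const))
  have hp₁d : ∀ t, HasDerivAt p₁ 8 t := fun t ↦ by
    have h := (((hasDerivAt_id t).add_const (3 / 8 : ℝ)).const_mul (8:ℝ)).const_add (p₂ (-(3 / 8)) - 1)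
    rw [mul_one] at h
    exact h
  have hp₂d : ∀ t ∈ Ioo (-(1 / 2) : ℝ) 1, HasDerivAt p₂ (-deriv D.Eup t) t := fun t ht ↦
    ((D.contDiff_Eup.differentiable (by simp)) t).hasDerivAt.const_sub 1
  have hp₂mono : MonotoneOn p₂ (Icc (-(1 / 2) : ℝ) 1) := fun s hs t ht hst ↦ by
    show 1 - D.Eup s ≤ 1 - D.Eup t
    linarith [D.strictAntiOn_Eup.antitoneOn hs ht hst]
  obtain ⟨H, hHs, hl, hr, hd, -⟩ := exists_blend_deriv_pos (a := -(3 / 8)) (b := -(1 / 4)) (by norm_num)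
    hp₁s hp₂s
    (fun t ht ↦ by
      have h1 : p₁ t ≤ p₂ (-(3 / 8)) := by rw [hp₁]; simp only; linarith [ht.2]
      exact h1.trans (hp₂mono ⟨by norm_num, by norm_num⟩ ⟨by linarith [ht.1], by linarith [ht.2]⟩ ht.1))
    (fun t _ ↦ by rw [(hp₁d t).deriv]; norm_num)
    (fun t ht ↦ by
      have hneg := D.deriv_Eup_neg (t := t) ⟨by linarith [ht.1], by linarith [ht.2]⟩
      rw [(hp₂d t ⟨by linarith [ht.1], by linarith [ht.2]⟩).deriv]
      exact neg_pos.2 hneg)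
  refine ⟨H, hHs, hr, fun t ht ↦ ?_⟩
  rcases lt_or_ge t (-(3 / 8)) with h1 | h1
  · have hev : H =ᶠ[𝓝 t] p₁ := by
      filter_upwards [Iio_mem_nhds h1] with s hs using hl s hs.le
    rw [hev.deriv_eq, (hp₁d t).deriv]; norm_num
  rcases le_or_gt t (-(1 / 4)) with h2 | h2
  · exact hd t ⟨h1, h2⟩
  · have hev : H =ᶠ[𝓝 t] p₂ := by
      filter_upwards [Ioi_mem_nhds h2] with s hs using hr s hs.le
    have hneg := D.deriv_Eup_neg (t := t) ⟨by linarith, by linarith⟩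
    rw [hev.deriv_eq, (hp₂d t ⟨by linarith, by linarith⟩).deriv]
    exact neg_pos.2 hneg

/-- The left profile of the reflected upper arch. [folklore] -/
def fUp : ℝ → ℝ := Classical.choose D.exists_fUp

/-- The defining properties of `fUp`. [folklore] -/
theorem fUp_spec : ContDiff ℝ ∞ D.fUp ∧ (∀ t, -(1 / 4) ≤ t → D.fUp t = 1 - D.Eup t) ∧
    ∀ t, t ≤ 1 / 4 → 0 < deriv D.fUp t := Classical.choose_spec D.exists_fUp

/-- **The right profile of the reflected upper arch**: the affine function
`gUp t = 1 - θaffInv (uD + c₁ t)` (so that the reflected end `pt2 0 (1 - gUp t)` is the core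
point with parameter `uD + c₁ t`). [folklore] -/
def gUp (t : ℝ) : ℝ := 1 - C.θaffInv (D.uD + D.c₁ * t)

/-- `gUp` is `C^∞` with derivative `-v`. [folklore] -/
theorem hasDerivAt_gUp (t : ℝ) : HasDerivAt D.gUp (-D.v) t := by
  unfold gUp ChartData.θaffInv
  have h := (((((hasDerivAt_id t).const_mul D.c₁).const_add D.uD).sub_const C.θlo).div_const C.slope).sub_const C.δ
  have h2 := h.const_sub 1
  exact h2.congr_deriv (by rw [v]; ring)

/-- `gUp` is `C^∞`. [folklore] -/
theorem contDiff_gUp : ContDiff ℝ ∞ D.gUp :=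
  contDiff_const.sub (C.contDiff_θaffInv.comp (contDiff_const.add (contDiff_const.mul contDiff_id)))

/-- `gUp 1 = -δ`. [folklore] -/
theorem gUp_one : D.gUp 1 = -C.δ := by
  rw [gUp, mul_one, uD, sub_add_cancel, ChartData.θaffInv_θhi]; ring

/-- Values of `gUp` on `(0, 1)`: in `(-δ, 1/2)`. [folklore] -/
theorem gUp_mem {t : ℝ} (ht : t ∈ Ioo (0 : ℝ) 1) : D.gUp t ∈ Ioo (-C.δ) (1 / 2) := by
  have hv := D.v_pos
  have hv' := D.v_le
  have e : D.gUp t = -C.δ + D.v * (1 - t) := by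
    rw [gUp, uD, ChartData.θaffInv, v, ChartData.slope, ChartData.wid]
    have h1 : (1 + 2 * C.δ) ≠ 0 := by linarith [C.δ_pos]
    have h2 : C.θhi - C.θlo ≠ 0 := by linarith [C.θlo_lt]
    field_simp
    ring
  rw [e]
  constructor
  · nlinarith [ht.2]
  · nlinarith [ht.1, C.δ_pos]

/-- **The reflected upper arch exists** (`exists_planarArch`). [folklore] -/
theorem exists_cUp' : ∃ c : ℝ → 𝔼 2, ContDiff ℝ ∞ c ∧
    (∀ t, t ≤ 0 + 1 / 8 → c t = pt2 0 (D.fUp t)) ∧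
    (∀ t, 1 - 1 / 8 ≤ t → c t = pt2 1 (D.gUp t)) ∧
    (∀ t ∈ Ioo (0 + 1 / 8) (1 - 1 / 8), c t 0 ∈ Ioo (0 : ℝ) 1) ∧
    (∀ t, c t 0 ∈ Icc (0 : ℝ) 1) ∧
    (∀ t, c t 1 ∈ uIcc (D.fUp t) (D.gUp t)) ∧
    Injective c ∧ ∀ t, deriv c t ≠ 0 :=
  exists_planarArch (θ₁ := 0) (θ₂ := 1) (ε := 1 / 8) (by norm_num) (by norm_num)
    D.fUp_spec.1 D.contDiff_gUp
    (fun t ht ↦ D.fUp_spec.2.2 t (by linarith))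
    (fun t _ ↦ by rw [(D.hasDerivAt_gUp t).deriv]; linarith [D.v_pos])

/-- The reflected upper arch. [folklore] -/
def cUp' : ℝ → 𝔼 2 := Classical.choose D.exists_cUp'

/-- The defining properties of the reflected upper arch. [folklore] -/
theorem cUp'_spec : ContDiff ℝ ∞ D.cUp' ∧
    (∀ t, t ≤ 0 + 1 / 8 → D.cUp' t = pt2 0 (D.fUp t)) ∧
    (∀ t, 1 - 1 / 8 ≤ t → D.cUp' t = pt2 1 (D.gUp t)) ∧
    (∀ t ∈ Ioo (0 + 1 / 8) (1 - 1 / 8), D.cUp' t 0 ∈ Ioo (0 : ℝ) 1) ∧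
    (∀ t, D.cUp' t 0 ∈ Icc (0 : ℝ) 1) ∧
    (∀ t, D.cUp' t 1 ∈ uIcc (D.fUp t) (D.gUp t)) ∧
    Injective D.cUp' ∧ ∀ t, deriv D.cUp' t ≠ 0 := Classical.choose_spec D.exists_cUp'

/-- **The upper arch** in square coordinates: the reflection `(1, 1) - cUp'` of the reflected
arch, from the upper-right corner to the upper-left corner. [folklore] -/
def cUp (t : ℝ) : 𝔼 2 := pt2 1 1 - D.cUp' t

/-- Coordinates of the upper arch. [folklore] -/
theorem cUp_apply (t : ℝ) (i : Fin 2) : D.cUp t i = 1 - D.cUp' t i := by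
  fin_cases i <;> simp [cUp]

/-- Near its start, and one quarter before, the upper arch runs down the right edge line along
`Ẽ`. [folklore] -/
theorem cUp_of_mem {t : ℝ} (ht : t ∈ Icc (-(1 / 4) : ℝ) (1 / 8)) : D.cUp t = pt2 1 (D.Eup t) := by
  rw [cUp, D.cUp'_spec.2.1 t (by linarith [ht.2]), D.fUp_spec.2.1 t ht.1]
  ext i; fin_cases i <;> simp

/-- Near its end the upper arch runs along the left edge line, as the core continuation:
`cUp t = pt2 0 (θaffInv (uD + c₁ t))` for `t ≥ 7/8`. [folklore] -/
theorem cUp_of_ge {t : ℝ} (ht : 7 / 8 ≤ t) : D.cUp t = pt2 0 (C.θaffInv (D.uD + D.c₁ * t)) := by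
  rw [cUp, D.cUp'_spec.2.2.1 t (by linarith), gUp]
  ext i; fin_cases i <;> simp

/-- The upper arch starts at the upper-right corner. [folklore] -/
theorem cUp_zero : D.cUp 0 = pt2 1 (1 + C.δ) := by
  rw [D.cUp_of_mem ⟨by norm_num, by norm_num⟩, Eup_zero]

/-- The upper arch ends at the upper-left corner. [folklore] -/
theorem cUp_one : D.cUp 1 = pt2 0 (1 + C.δ) := by
  rw [D.cUp_of_ge (by norm_num), mul_one, uD, sub_add_cancel, ChartData.θaffInv_θhi]

/-- The upper arch is `C^∞`. [folklore] -/
theorem contDiff_cUp : ContDiff ℝ ∞ D.cUp := contDiff_const.sub D.cUp'_spec.1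

/-- The upper arch is injective. [folklore] -/
theorem injective_cUp : Injective D.cUp := fun _ _ h ↦ D.cUp'_spec.2.2.2.2.2.2.1 (sub_right_injective h)

/-- The upper arch is regular. [folklore] -/
theorem deriv_cUp_ne_zero (t : ℝ) : deriv D.cUp t ≠ 0 := by
  have hd := ((D.cUp'_spec.1.differentiable (by simp)) t).hasDerivAt
  rw [show D.cUp = fun t ↦ pt2 1 1 - D.cUp' t from rfl, (hd.const_sub _).deriv, neg_ne_zero]
  exact D.cUp'_spec.2.2.2.2.2.2.2 t

/-- Values of `1 - Ẽ` on `(0, 1)`: in `(-δ, 1/2)`. [folklore] -/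
theorem one_sub_Eup_mem {t : ℝ} (ht : t ∈ Ioo (0 : ℝ) 1) : 1 - D.Eup t ∈ Ioo (-C.δ) (1 / 2) := by
  have h1 : D.Eup t < D.Eup 0 :=
    D.strictAntiOn_Eup ⟨by norm_num, by norm_num⟩ ⟨by linarith [ht.1], ht.2.le⟩ ht.1
  rw [Eup_zero] at h1
  have h2 := D.abs_Eup_sub_lt ⟨by linarith [ht.1], ht.2.le⟩
  rw [abs_lt] at h2
  constructor
  · linarith
  · linarith [h2.1, C.δ_le]

/-- **The open upper arch lies in the upper half of the square neighbourhood.** [folklore] -/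
theorem cUp_mem {t : ℝ} (ht : t ∈ Ioo (0 : ℝ) 1) : D.cUp t ∈ squareNhd C.δ ∧ 2⁻¹ < D.cUp t 1 := by
  have hδ := C.δ_pos
  have h0 := D.cUp'_spec.2.2.2.2.1 t
  have h1 := D.cUp'_spec.2.2.2.2.2.1 t
  rw [D.fUp_spec.2.1 t (by linarith [ht.1])] at h1
  have hf := D.one_sub_Eup_mem ht
  have hg := D.gUp_mem ht
  have h1' : D.cUp' t 1 ∈ Ioo (-C.δ) (1 / 2) := by
    rcases le_total (1 - D.Eup t) (D.gUp t) with hle | hle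
    · rw [uIcc_of_le hle] at h1; exact ⟨lt_of_lt_of_le hf.1 h1.1, lt_of_le_of_lt h1.2 hg.2⟩
    · rw [uIcc_of_ge hle] at h1; exact ⟨lt_of_lt_of_le hg.1 h1.1, lt_of_le_of_lt h1.2 hf.2⟩
  refine ⟨fun i ↦ ?_, ?_⟩
  · fin_cases i
    · change D.cUp t 0 ∈ Ioo (-C.δ) (1 + C.δ)
      rw [cUp_apply]
      exact ⟨by linarith [h0.2], by linarith [h0.1]⟩
    · change D.cUp t 1 ∈ Ioo (-C.δ) (1 + C.δ)
      rw [cUp_apply]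
      exact ⟨by linarith [h1'.2], by linarith [h1'.1]⟩
  · rw [cUp_apply]
    norm_num at h1' ⊢
    linarith [h1'.2]

end SegData

end BandFoliation

end Literature.Topology.FourManifolds
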